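import Literature.MeasureTheory.Group.QuotientAveraging
import Mathlib.Topology.Algebra.InfiniteSum.Basic
import Mathlib.Analysis.Normed.Group.Basic
import HarnessLib

/-!
# [Li1992, p. 183–184] — DESCENT of the locally uniform convergence of Rallis' orbital sums to ONE bound on `G × G`
# (bookkeeping for the kernel form of the inner product formula)

J.-S. Li, J. reine angew. Math. **428** (1992), p. 183 L-12–L-1 and (24) p. 184: the orbital sums
`Σ_{γ ∈ G'(k)} |⟨ω(h₂⁻¹ γ h₁)φ₁, φ₂⟩|` converge «uniformly for `(h₁, h₂)` in compact sets», and `G'(k)\G'(A)` is compact.  The tree's kernel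
letter ★ `Weil1964.ThetaKernelDatum.KernelRallisIdentity` (`Li1992/RallisKernelIdentity.lean` §2) asks for ONE bound `B` for ALL
`(x₁, x₂) ∈ G × G` of `Σ_{γ ∈ Γ} ‖c (x₂ γ x₁⁻¹)‖`.  THIS FILE is the group-theoretic descent between the two (E-2 lead ruling, cell bus
`F0/P4/STATUS.md` 2026-08-31 00:47Z, junction J-E2-2′ of the child line `Cruxes/H413/Lines/F0_E2SiegelWeilWeilRange.lean`):

* `tsum_orbitWord_mul_mul` ∕ `summable_orbitWord_mul_mul_iff` — the orbital sum over the word `x₂ γ x₁⁻¹` is `Γ × Γ`-INVARIANT: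
  replacing `(x₁, x₂)` by `(x₁ γ₁, x₂ γ₂)` reindexes the sum along `γ ↦ γ₂ γ γ₁⁻¹ : Γ ≃ Γ`;
* `orbitSum_bound_of_fundamental` — a bound valid on a set `C ⊆ G × G` meeting every right `Γ × Γ`-orbit is valid on `G × G`;
* `exists_isCompact_prod_fundamental` — for `G` locally compact with `G ⧸ Γ` compact there is a COMPACT such `C` (★
  `WeilQuotient.exists_isCompact_image_mk_superset` squared) — this is stub SW1(ii) of the child line, already in the tree;
* **`orbitSum_global_bound_of_compacta`** — «a bound on every compact of `G × G`» ⟹ «ONE bound on `G × G`», the shape consumed by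
  `kernelRallisIdentity_of`.

KERNEL only: theorems, no definition, no `sorry`; generic over a group `G`, a subgroup `Γ` and a seminormed target.  Cell hodgecm-mathlib,
FLOOR 0, engine E-2 (S6), crux item H413 (`--supports stmt-HodgeConjecture-24833`).  HC_CM is proved only modulo the printed citations until
rung 0 closes.

## References
* [Li1992] J.-S. Li, J. reine angew. Math. 428 (1992) 177–217 — p. 183, (24) p. 184.
-/

set_option autoImplicit false

open Set

namespace Literature.NumberTheory.Li1992

namespace OrbitSumDescent

section Reindex

variable {G : Type*} [Group G] (Γ : Subgroup G) {α : Type*} [AddCommMonoid α] [TopologicalSpace α]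

/-- the word identity behind the reindexing: `x₂ γ₂ · γ · (x₁ γ₁)⁻¹ = x₂ · (γ₂ γ γ₁⁻¹) · x₁⁻¹`. [folklore] -/
private theorem orbitWord_mul_mul (x₁ x₂ : G) (γ₁ γ₂ γ : Γ) :
    x₂ * (γ₂ : G) * (γ : G) * (x₁ * (γ₁ : G))⁻¹ =
      x₂ * (((Equiv.mulLeft γ₂).trans (Equiv.mulRight γ₁⁻¹) γ : Γ) : G) * x₁⁻¹ := by
  simp only [Equiv.trans_apply, Equiv.coe_mulLeft, Equiv.coe_mulRight, Subgroup.coe_mul, Subgroup.coe_inv, mul_inv_rev,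
    mul_assoc]

/-- **`Γ × Γ`-INVARIANCE OF THE ORBITAL SUM**: `Σ_{γ ∈ Γ} f (x₂γ₂ · γ · (x₁γ₁)⁻¹) = Σ_{γ ∈ Γ} f (x₂ · γ · x₁⁻¹)` (reindex along
`γ ↦ γ₂ γ γ₁⁻¹ : Γ ≃ Γ`; no convergence hypothesis — both sides are `tsum`s). [cite: Li1992, (24) p. 184] -/
theorem tsum_orbitWord_mul_mul (f : G → α) (x₁ x₂ : G) (γ₁ γ₂ : Γ) :
    ∑' γ : Γ, f (x₂ * (γ₂ : G) * (γ : G) * (x₁ * (γ₁ : G))⁻¹) = ∑' γ : Γ, f (x₂ * (γ : G) * x₁⁻¹) := by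
  simp only [orbitWord_mul_mul Γ]
  exact Equiv.tsum_eq _ (fun δ : Γ => f (x₂ * (δ : G) * x₁⁻¹))

/-- … and of absolute convergence: `Summable (γ ↦ f (x₂γ₂ · γ · (x₁γ₁)⁻¹)) ↔ Summable (γ ↦ f (x₂ · γ · x₁⁻¹))`. [cite: Li1992, p. 183] -/
theorem summable_orbitWord_mul_mul_iff (f : G → α) (x₁ x₂ : G) (γ₁ γ₂ : Γ) :
    Summable (fun γ : Γ => f (x₂ * (γ₂ : G) * (γ : G) * (x₁ * (γ₁ : G))⁻¹)) ↔
      Summable (fun γ : Γ => f (x₂ * (γ : G) * x₁⁻¹)) := by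
  simp only [orbitWord_mul_mul Γ]
  exact Equiv.summable_iff _ (f := fun δ : Γ => f (x₂ * (δ : G) * x₁⁻¹))

end Reindex

section Descent

variable {G : Type*} [Group G] (Γ : Subgroup G) {E : Type*} [SeminormedAddCommGroup E]

/-- **DESCENT TO A FUNDAMENTAL SET**: if `C ⊆ G × G` meets every right `Γ × Γ`-orbit and the orbital sums `Σ_γ ‖f (x₂ γ x₁⁻¹)‖` converge
with the bound `B` for `(x₁, x₂) ∈ C`, they converge with the bound `B` for ALL `(x₁, x₂)`. [cite: Li1992, p. 183 and (24) p. 184] -/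
theorem orbitSum_bound_of_fundamental (f : G → E) {C : Set (G × G)}
    (hC : ∀ x₁ x₂ : G, ∃ γ₁ γ₂ : Γ, (x₁ * (γ₁ : G), x₂ * (γ₂ : G)) ∈ C) {B : ℝ}
    (hB : ∀ x₁ x₂ : G, (x₁, x₂) ∈ C →
      Summable (fun γ : Γ => ‖f (x₂ * (γ : G) * x₁⁻¹)‖) ∧ ∑' γ : Γ, ‖f (x₂ * (γ : G) * x₁⁻¹)‖ ≤ B)
    (x₁ x₂ : G) :
    Summable (fun γ : Γ => ‖f (x₂ * (γ : G) * x₁⁻¹)‖) ∧ ∑' γ : Γ, ‖f (x₂ * (γ : G) * x₁⁻¹)‖ ≤ B := by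
  obtain ⟨γ₁, γ₂, h⟩ := hC x₁ x₂
  obtain ⟨hs, hb⟩ := hB _ _ h
  rw [summable_orbitWord_mul_mul_iff Γ (fun h : G => ‖f h‖)] at hs
  rw [tsum_orbitWord_mul_mul Γ (fun h : G => ‖f h‖)] at hb
  exact ⟨hs, hb⟩

/-- the bound `B` of a non-empty family of convergent non-negative sums is `≥ 0` — bookkeeping used by consumers that start from
`B := 0` on an empty compact. [folklore] -/
private theorem bound_nonneg_of_orbitSum_le (f : G → E) {B : ℝ} (x₁ x₂ : G)
    (h : ∑' γ : Γ, ‖f (x₂ * (γ : G) * x₁⁻¹)‖ ≤ B) : 0 ≤ B :=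
  (tsum_nonneg fun _ => norm_nonneg _).trans h

variable [TopologicalSpace G]

/-- **SW1(ii) — A COMPACT FUNDAMENTAL SET IN `G × G`**: for `G` locally compact with `G ⧸ Γ` compact there is a compact `C ⊆ G × G` meeting
every right `Γ × Γ`-orbit: `∀ x₁ x₂, ∃ γ₁ γ₂ ∈ Γ, (x₁γ₁, x₂γ₂) ∈ C` (★ `WeilQuotient.exists_isCompact_image_mk_superset` applied to
`univ ⊆ G ⧸ Γ`, squared). [cite: Li1992, p. 184 («`G'(k)\G'(A)`» compact)] -/
theorem exists_isCompact_prod_fundamental [IsTopologicalGroup G] [LocallyCompactSpace G] [CompactSpace (G ⧸ Γ)] :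
    ∃ C : Set (G × G), IsCompact C ∧ ∀ x₁ x₂ : G, ∃ γ₁ γ₂ : Γ, (x₁ * (γ₁ : G), x₂ * (γ₂ : G)) ∈ C := by
  obtain ⟨A, hA, hcov⟩ := Literature.MeasureTheory.Group.WeilQuotient.exists_isCompact_image_mk_superset (H := Γ)
    (isCompact_univ : IsCompact (univ : Set (G ⧸ Γ)))
  have key : ∀ x : G, ∃ γ : Γ, x * (γ : G) ∈ A := fun x => by
    obtain ⟨y, hy, hyx⟩ := hcov (mem_univ (QuotientGroup.mk x : G ⧸ Γ))
    rw [QuotientGroup.eq] at hyx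
    refine ⟨⟨(y⁻¹ * x)⁻¹, Γ.inv_mem hyx⟩, ?_⟩
    rw [Subgroup.coe_mk, mul_inv_rev, inv_inv, mul_inv_cancel_left]
    exact hy
  refine ⟨A ×ˢ A, hA.prod hA, fun x₁ x₂ => ?_⟩
  obtain ⟨γ₁, h₁⟩ := key x₁
  obtain ⟨γ₂, h₂⟩ := key x₂
  exact ⟨γ₁, γ₂, mk_mem_prod h₁ h₂⟩

/-- **«A BOUND ON EVERY COMPACT OF `G × G`» ⟹ «ONE BOUND ON `G × G`»** for the orbital sums `Σ_{γ ∈ Γ} ‖f (x₂ γ x₁⁻¹)‖`, when `G` is locally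
compact and `G ⧸ Γ` compact — the descent of print's locally uniform convergence to the global bound of ★ `KernelRallisIdentity`
(junction J-E2-2′: SW2 delivers the hypothesis, `kernelRallisIdentity_of` consumes the conclusion). [cite: Li1992, p. 183 and (24) p. 184] -/
theorem orbitSum_global_bound_of_compacta [IsTopologicalGroup G] [LocallyCompactSpace G] [CompactSpace (G ⧸ Γ)] (f : G → E)
    (hloc : ∀ C : Set (G × G), IsCompact C → ∃ B : ℝ, ∀ x₁ x₂ : G, (x₁, x₂) ∈ C →
      Summable (fun γ : Γ => ‖f (x₂ * (γ : G) * x₁⁻¹)‖) ∧ ∑' γ : Γ, ‖f (x₂ * (γ : G) * x₁⁻¹)‖ ≤ B) :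
    ∃ B : ℝ, ∀ x₁ x₂ : G,
      Summable (fun γ : Γ => ‖f (x₂ * (γ : G) * x₁⁻¹)‖) ∧ ∑' γ : Γ, ‖f (x₂ * (γ : G) * x₁⁻¹)‖ ≤ B := by
  obtain ⟨C, hC, hfund⟩ := exists_isCompact_prod_fundamental Γ
  obtain ⟨B, hB⟩ := hloc C hC
  exact ⟨B, orbitSum_bound_of_fundamental Γ f hfund hB⟩

/-- **pointwise variant**: the same with the local hypothesis stated point-by-point on compacta («for every compact `C` and every
`(x₁, x₂) ∈ C` the sum converges, and `sup_C < ∞`»), delivering ALSO `0 ≤ B`. [cite: Li1992, p. 183 and (24) p. 184] -/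
theorem orbitSum_global_bound_of_compacta' [IsTopologicalGroup G] [LocallyCompactSpace G] [CompactSpace (G ⧸ Γ)] (f : G → E)
    (hloc : ∀ C : Set (G × G), IsCompact C → ∃ B : ℝ, ∀ x₁ x₂ : G, (x₁, x₂) ∈ C →
      Summable (fun γ : Γ => ‖f (x₂ * (γ : G) * x₁⁻¹)‖) ∧ ∑' γ : Γ, ‖f (x₂ * (γ : G) * x₁⁻¹)‖ ≤ B) :
    ∃ B : ℝ, 0 ≤ B ∧ ∀ x₁ x₂ : G,
      Summable (fun γ : Γ => ‖f (x₂ * (γ : G) * x₁⁻¹)‖) ∧ ∑' γ : Γ, ‖f (x₂ * (γ : G) * x₁⁻¹)‖ ≤ B := by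
  obtain ⟨B, hB⟩ := orbitSum_global_bound_of_compacta Γ f hloc
  exact ⟨B, bound_nonneg_of_orbitSum_le Γ f 1 1 (hB 1 1).2, hB⟩

end Descent

end OrbitSumDescent

end Literature.NumberTheory.Li1992
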